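import Mathlib.MeasureTheory.Function.ConvergenceInMeasure
import Mathlib.Topology.MetricSpace.Basic
import HarnessLib

/-!
# Route `ColdStartUniversality` (fixed-cut-off SZZ dynamics, sampler package): algebra of convergence IN PROBABILITY to constants

Helper file (seat `ym-line-csu-p1`, g35; `--supports stmt-QuantumFields-24809`).  Small generic lemmas (any measure space, any filter) used by the
plug-in estimators of the sampler package: sequences converging in measure to CONSTANTS can be paired (`tendstoInMeasure_prodMk_of_const`),
pushed through a map continuous at the limit point (`tendstoInMeasure_continuousAt_comp_of_const`), added, subtracted, multiplied and summed
over a `Finset` (`tendstoInMeasure_add_of_const`, `…sub…`, `…mul…`, `tendstoInMeasure_sum_of_const`); a constant sequence converges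
(`tendstoInMeasure_const_of_const`).  No measurability hypotheses are needed.  THEOREMS ONLY; [folklore].
HONEST FRAMING: bookkeeping; nothing here concerns `UniformColdStartMixing` (24809) or the Yang–Mills mass gap, which are NOT proved.
-/

set_option autoImplicit false

namespace Summit.QuantumFields.YangMills.Theorems.ColdStartUniversality

open MeasureTheory Filter Topology Set
open scoped BigOperators

/-- A constant sequence converges in measure to its value. [folklore] -/
theorem tendstoInMeasure_const_of_const {ι Ω E : Type*} {mΩ : MeasurableSpace Ω} {P : Measure Ω} [PseudoMetricSpace E]
    {l : Filter ι} (c : E) : TendstoInMeasure P (fun (_ : ι) (_ : Ω) => c) l fun _ => c := by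
  rw [tendstoInMeasure_iff_dist]
  intro ε hε
  have : {ω : Ω | ε ≤ dist c c} = ∅ := Set.eq_empty_of_forall_notMem fun ω hω => by
    rw [Set.mem_setOf_eq, dist_self] at hω; exact (not_le.2 hε) hω
  simp only [this, measure_empty, tendsto_const_nhds]

/-- Pairing: `X_n → a`, `Y_n → b` in measure (constants) ⇒ `(X_n, Y_n) → (a, b)` in measure. [folklore] -/
theorem tendstoInMeasure_prodMk_of_const {ι Ω E F : Type*} {mΩ : MeasurableSpace Ω} {P : Measure Ω} [PseudoMetricSpace E]
    [PseudoMetricSpace F] {l : Filter ι} {X : ι → Ω → E} {Y : ι → Ω → F} {a : E} {b : F}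
    (hX : TendstoInMeasure P X l fun _ => a) (hY : TendstoInMeasure P Y l fun _ => b) :
    TendstoInMeasure P (fun n ω => (X n ω, Y n ω)) l fun _ => (a, b) := by
  rw [tendstoInMeasure_iff_dist] at hX hY ⊢
  intro ε hε
  have h := (hX ε hε).add (hY ε hε)
  rw [add_zero] at h
  refine tendsto_of_tendsto_of_tendsto_of_le_of_le tendsto_const_nhds h (fun n => bot_le) fun n => ?_
  refine (measure_mono fun ω hω => ?_).trans (measure_union_le _ _)
  simp only [Set.mem_setOf_eq, Set.mem_union, Prod.dist_eq, le_max_iff] at hω ⊢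
  exact hω

/-- Continuous mapping at a point: `X_n → c` in measure and `f` continuous at `c` ⇒ `f(X_n) → f(c)` in measure. [folklore] -/
theorem tendstoInMeasure_continuousAt_comp_of_const {ι Ω E F : Type*} {mΩ : MeasurableSpace Ω} {P : Measure Ω} [PseudoMetricSpace E]
    [PseudoMetricSpace F] {l : Filter ι} {f : E → F} {c : E} (hf : ContinuousAt f c) {X : ι → Ω → E}
    (hX : TendstoInMeasure P X l fun _ => c) : TendstoInMeasure P (fun n ω => f (X n ω)) l fun _ => f c := by
  rw [tendstoInMeasure_iff_dist] at hX ⊢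
  intro ε hε
  obtain ⟨δ, hδ, hδε⟩ := Metric.continuousAt_iff.1 hf ε hε
  refine tendsto_of_tendsto_of_tendsto_of_le_of_le tendsto_const_nhds (hX δ hδ) (fun n => bot_le) fun n =>
    measure_mono fun ω hω => ?_
  simp only [Set.mem_setOf_eq] at hω ⊢
  by_contra hlt
  exact (not_lt.2 hω) (hδε (not_le.1 hlt))

/-- Sums: `X_n → a`, `Y_n → b` in measure ⇒ `X_n + Y_n → a + b`. [folklore] -/
theorem tendstoInMeasure_add_of_const {ι Ω : Type*} {mΩ : MeasurableSpace Ω} {P : Measure Ω} {l : Filter ι} {X Y : ι → Ω → ℝ}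
    {a b : ℝ} (hX : TendstoInMeasure P X l fun _ => a) (hY : TendstoInMeasure P Y l fun _ => b) :
    TendstoInMeasure P (fun n ω => X n ω + Y n ω) l fun _ => a + b := by
  -- elaborate WITHOUT the expected type (higher-order unification of `?f (?X n ω)` against the goal diverges), then `exact`
  have hc : ContinuousAt (fun p : ℝ × ℝ => p.1 + p.2) (a, b) := continuous_add.continuousAt
  have h := tendstoInMeasure_continuousAt_comp_of_const hc (tendstoInMeasure_prodMk_of_const hX hY)
  exact h

/-- Differences: `X_n → a`, `Y_n → b` in measure ⇒ `X_n − Y_n → a − b`. [folklore] -/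
theorem tendstoInMeasure_sub_of_const {ι Ω : Type*} {mΩ : MeasurableSpace Ω} {P : Measure Ω} {l : Filter ι} {X Y : ι → Ω → ℝ}
    {a b : ℝ} (hX : TendstoInMeasure P X l fun _ => a) (hY : TendstoInMeasure P Y l fun _ => b) :
    TendstoInMeasure P (fun n ω => X n ω - Y n ω) l fun _ => a - b := by
  -- elaborate WITHOUT the expected type (higher-order unification of `?f (?X n ω)` against the goal diverges), then `exact`
  have hc : ContinuousAt (fun p : ℝ × ℝ => p.1 - p.2) (a, b) := continuous_sub.continuousAt
  have h := tendstoInMeasure_continuousAt_comp_of_const hc (tendstoInMeasure_prodMk_of_const hX hY)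
  exact h

/-- Products: `X_n → a`, `Y_n → b` in measure ⇒ `X_n Y_n → ab`. [folklore] -/
theorem tendstoInMeasure_mul_of_const {ι Ω : Type*} {mΩ : MeasurableSpace Ω} {P : Measure Ω} {l : Filter ι} {X Y : ι → Ω → ℝ}
    {a b : ℝ} (hX : TendstoInMeasure P X l fun _ => a) (hY : TendstoInMeasure P Y l fun _ => b) :
    TendstoInMeasure P (fun n ω => X n ω * Y n ω) l fun _ => a * b := by
  -- elaborate WITHOUT the expected type (higher-order unification of `?f (?X n ω)` against the goal diverges), then `exact`
  have hc : ContinuousAt (fun p : ℝ × ℝ => p.1 * p.2) (a, b) := continuous_mul.continuousAt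
  have h := tendstoInMeasure_continuousAt_comp_of_const hc (tendstoInMeasure_prodMk_of_const hX hY)
  exact h

/-- Finite sums: termwise convergence in measure to constants ⇒ convergence of the `Finset` sum. [folklore] -/
theorem tendstoInMeasure_sum_of_const {ι Ω K : Type*} {mΩ : MeasurableSpace Ω} {P : Measure Ω} {l : Filter ι} (s : Finset K)
    {X : K → ι → Ω → ℝ} {a : K → ℝ} (h : ∀ k ∈ s, TendstoInMeasure P (X k) l fun _ => a k) :
    TendstoInMeasure P (fun n ω => ∑ k ∈ s, X k n ω) l fun _ => ∑ k ∈ s, a k := by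
  classical
  induction s using Finset.induction_on with
  | empty => simpa only [Finset.sum_empty] using tendstoInMeasure_const_of_const (P := P) (l := l) (0 : ℝ)
  | insert k s hk ih =>
    simp only [Finset.sum_insert hk]
    exact tendstoInMeasure_add_of_const (h k (Finset.mem_insert_self k s)) (ih fun k' hk' => h k' (Finset.mem_insert_of_mem hk'))

end Summit.QuantumFields.YangMills.Theorems.ColdStartUniversality
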